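import Literature.MathematicalPhysics.QuantumFieldTheory.Balaban1983to89.B4Strip
import HarnessLib

/-!
# The aliasing (Parseval) identity of block averaging: `Σ_l |u_k^η(p′+l)|² = 1`

**Citation header (reproduction of PUBLISHED work; template file of the Bałaban lattice Yang–Mills
cell `pub-balaban`, TEMPLATE.md §18.6).**
C. King, *The U(1) Higgs model. I. The continuum limit*, Commun. Math. Phys. **102** (1986) 649–677
[King1986], §4 p. 671, the sentence closing the proof of Lemma 4.1: "Since `Σ_l |u^η_k(p′+l)|² = 1`,
the bound (4.9) follows."  Here (4.3) `u^η_k(p) = Π_{μ=1}^d [(e^{−ip_μ} − 1) η (e^{−iηp_μ} − 1)^{−1}]`,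
`η = L^{−k}`, and `l` runs over the `L^{kd}` aliases `l ∈ 2πℤ^d`, `|l_μ| ≤ π(L^k − 1)` for `L` odd
(`−πL^k ≤ l_μ ≤ πL^k` for `L` even) (p. 670).  The same WEIGHTS `|u_j(p′+l′)|²` — defined in
T. Bałaban, *Regularity and decay of lattice Green's functions*, Commun. Math. Phys. **89** (1983) 571–597
[Balaban1983RegularityDecay] at (2.45) p. 584 — enter the alias sums of that paper's (2.46)–(2.49)
pp. 584–585 and of *Propagators and renormalization transformations … I*, CMP **95** (1984) (1.45) p. 26
(those displays do not themselves invoke the normalisation `Σ_l |u|² = 1`; King's p. 671 sentence is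
the located printed use).  Context, not cited by any declaration below: in position space the identity
is "`Q_jQ_j^* = 1`" (block averaging composed with its adjoint is the identity on block functions), as
recorded e.g. in Dybalski–Stottmeister–Tanimoto, Rev. Math. Phys. **36** (2024) 2430005
[DybalskiStottmeisterTanimoto2024GreenDecay] §2.3.  In `King1986.EffectiveLaplacianRate` it is the
hypothesis `Σ w = 1` of `composed_denominator_eq` / `composed_eq_effSymbol` and implies the hypothesis
`Σ w ≤ 1` (`hw1`) of `abs_effSymbol_sub_le`.
(v1.1: docstring-only revision for the cross-read C-pv05g4-1 / G-pv05g4-1 of `b2b-balaban-pv05-g4`;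
no declaration, statement, proof or cite tag changed.)

**What is proved here (everything PROVED; no named fact; classical trigonometry).**
* §1 discrete orthogonality of the `n`-th roots of unity:
  `Σ_{k<n} exp(2πi k m / n) = n·[n ∣ m]` in the form needed (`m = j − j′`, `0 ≤ j, j′ < n`);
* §2 the Dirichlet-type sum `S_n(φ) = Σ_{j<n} e^{2ijφ}`: `‖S_n(φ)‖²·sin²φ = sin²(nφ)` (for `sin φ ≠ 0`),
  and `Σ_{k<n} ‖S_n(θ + kπ/n)‖² = n²` (from §1);
* §3 the classical identity `Σ_{k=0}^{n−1} 1/sin²(θ + kπ/n) = n²/sin²(nθ)` (`sin(nθ) ≠ 0`), hence the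
  ONE-DIMENSIONAL ALIASING IDENTITY `Σ_{k=0}^{n−1} sin²(x/2) / (n² sin²((x+2πk)/(2n))) = 1`
  (`sin(x/2) ≠ 0`), i.e. `Σ_l |u(p′+l)|² = 1` for `|u(q)|² = |Σ_{j<n} e^{−ijq/n}/n|²
  = sin²(q/2)/(n² sin²(q/2n))`, `n = L^k = η⁻¹`;
* §4 the identity IN THE TREE'S VOCABULARY: for the real alias factors `uFactorr n k x` of the cell's
  module `Balaban1983to89.B4Strip` (= `|u_j(p′+l)|²` of B4 (2.45), one coordinate, alias `l = 2πk`, with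
  the removable singularity at `x = 0` filled in) one has `Σ_{k : Fin n} uFactorr n k x = 1` on the
  Brillouin zone `|x| ≤ π`, and for the `d`-dimensional product `Ur n k s = Π_μ uFactorr n (k μ) (s μ)`:
  `Σ_{k : Fin d → Fin n} Ur n k s = 1` whenever `|s_μ| ≤ π` for all `μ`.

Nothing in this file refers to or asserts anything about the analytic content of Bałaban's or King's
papers; it discharges an elementary identity both use silently.
-/

noncomputable section

open Finset Complex

namespace Literature.MathematicalPhysics.QuantumFieldTheory.King1986

/-! ## §1 Discrete orthogonality -/

/-- `exp(2πi m / n) = 1` for an integer `m` with `|m| < n` forces `m = 0`. [folklore] -/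
theorem exp_two_pi_mul_I_div_eq_one_iff {n : ℕ} (hn : n ≠ 0) {m : ℤ} (hm : |m| < n) :
    Complex.exp (2 * Real.pi * I * m / n) = 1 ↔ m = 0 := by
  constructor
  · intro h
    rw [Complex.exp_eq_one_iff] at h
    obtain ⟨N, hN⟩ := h
    have hn' : (n : ℂ) ≠ 0 := by exact_mod_cast hn
    have hπ : (Real.pi : ℂ) ≠ 0 := by exact_mod_cast Real.pi_ne_zero
    -- `m = N * n`
    have h1 : (m : ℂ) = N * n := by
      have hI : (I : ℂ) ≠ 0 := I_ne_zero
      have h0 : (2 * Real.pi * I : ℂ) * m = (2 * Real.pi * I) * (N * n) := by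
        have h3 := congrArg (fun z : ℂ => z * n) hN
        simp only [div_mul_cancel₀ _ hn'] at h3
        linear_combination h3
      have h2 : (2 * Real.pi * I : ℂ) ≠ 0 := by
        apply mul_ne_zero (mul_ne_zero two_ne_zero hπ) hI
      exact mul_left_cancel₀ h2 h0
    have h2 : m = N * n := by exact_mod_cast h1
    -- `|N * n| < n` forces `N = 0`
    by_contra hm0
    have hN0 : N ≠ 0 := by
      rintro rfl; simp at h2; exact hm0 h2
    have : (n : ℤ) ≤ |m| := by
      rw [h2, abs_mul, Nat.abs_cast]
      have : (1 : ℤ) ≤ |N| := Int.one_le_abs hN0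
      nlinarith
    omega
  · rintro rfl; simp

/-- Discrete orthogonality: for `0 ≤ j, j′ < n`,
`Σ_{k<n} exp(2πi k (j − j′)/n) = n` if `j = j′` and `= 0` otherwise. [folklore] -/
theorem sum_exp_two_pi_mul_I_mul_div {n : ℕ} (hn : n ≠ 0) {j j' : ℕ} (hj : j < n) (hj' : j' < n) :
    ∑ k ∈ range n, Complex.exp (2 * Real.pi * I * ((j : ℂ) - j') / n * k)
      = if j = j' then (n : ℂ) else 0 := by
  set m : ℤ := (j : ℤ) - j' with hmdef
  have hmC : ((j : ℂ) - j') = (m : ℂ) := by rw [hmdef]; push_cast; ring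
  set ζ : ℂ := Complex.exp (2 * Real.pi * I * (m : ℂ) / n) with hζ
  have hterm : ∀ k : ℕ, Complex.exp (2 * Real.pi * I * ((j : ℂ) - j') / n * k) = ζ ^ k := by
    intro k
    rw [hmC, hζ, ← Complex.exp_nat_mul]; ring_nf
  simp_rw [hterm]
  by_cases hjj : j = j'
  · subst hjj
    have hm0 : m = 0 := by rw [hmdef]; ring
    have : ζ = 1 := by rw [hζ, hm0]; simp
    simp [this]
  · rw [if_neg hjj]
    have hm : |m| < n := by
      rw [hmdef, abs_lt]; constructor <;> omega
    have hζ1 : ζ ≠ 1 := by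
      rw [hζ]
      intro h
      have := (exp_two_pi_mul_I_div_eq_one_iff hn hm).mp h
      omega
    have hζn : ζ ^ n = 1 := by
      rw [hζ, ← Complex.exp_nat_mul]
      have hn' : (n : ℂ) ≠ 0 := by exact_mod_cast hn
      have : (n : ℂ) * (2 * Real.pi * I * (m : ℂ) / n) = (m : ℂ) * (2 * Real.pi * I) := by
        rw [mul_comm, div_mul_cancel₀ _ hn']; ring
      rw [this]
      exact Complex.exp_int_mul_two_pi_mul_I m
    rw [geom_sum_eq hζ1, hζn, sub_self, zero_div]

/-! ## §2 The Dirichlet-type sum `S_n(φ) = Σ_{j<n} e^{2ijφ}` -/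

/-- `S_n(φ) = Σ_{j<n} e^{2ijφ}`. [folklore] -/
def dirichletSum (n : ℕ) (φ : ℝ) : ℂ := ∑ j ∈ range n, Complex.exp (2 * I * φ * j)

/-- `S_n(φ) = Σ_{j<n} (e^{2iφ})^j`. [folklore] -/
theorem dirichletSum_eq_geom (n : ℕ) (φ : ℝ) :
    dirichletSum n φ = ∑ j ∈ range n, Complex.exp (2 * I * φ) ^ j := by
  unfold dirichletSum
  refine Finset.sum_congr rfl fun j _ => ?_
  rw [← Complex.exp_nat_mul]; ring_nf

/-- `‖e^{iα} − 1‖ = 2|sin(α/2)|` (Mathlib), in the form `‖e^{2iφ} − 1‖ = 2|sin φ|`. [folklore] -/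
theorem norm_exp_two_I_sub_one (φ : ℝ) :
    ‖Complex.exp (2 * I * φ) - 1‖ = 2 * |Real.sin φ| := by
  have h := Complex.norm_exp_I_mul_ofReal_sub_one (2 * φ)
  have e : (I * ((2 * φ : ℝ) : ℂ)) = 2 * I * φ := by push_cast; ring
  rw [e] at h
  rw [h]
  have : (2 * φ) / 2 = φ := by ring
  rw [this, Real.norm_eq_abs, abs_mul, abs_two]

/-- `‖S_n(φ)‖²·sin²φ = sin²(nφ)` when `sin φ ≠ 0` (geometric sum + `‖e^{iα} − 1‖ = 2|sin(α/2)|`).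
[folklore] -/
theorem norm_dirichletSum_sq_mul_sin_sq {n : ℕ} {φ : ℝ} (hφ : Real.sin φ ≠ 0) :
    ‖dirichletSum n φ‖ ^ 2 * Real.sin φ ^ 2 = Real.sin (n * φ) ^ 2 := by
  have hq : Complex.exp (2 * I * φ) ≠ 1 := by
    intro h
    have := norm_exp_two_I_sub_one φ
    rw [h, sub_self, norm_zero] at this
    have : |Real.sin φ| = 0 := by linarith
    exact hφ (abs_eq_zero.mp this)
  rw [dirichletSum_eq_geom, geom_sum_eq hq, norm_div]
  have hpow : Complex.exp (2 * I * φ) ^ n = Complex.exp (2 * I * ((n * φ : ℝ) : ℂ)) := by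
    rw [← Complex.exp_nat_mul]; push_cast; ring_nf
  rw [hpow, norm_exp_two_I_sub_one, norm_exp_two_I_sub_one]
  have h2 : 2 * |Real.sin φ| ≠ 0 := by positivity
  field_simp
  rw [sq_abs, sq_abs]
  ring

/-- conj of a term: `conj(e^{2ijφ}) = e^{−2ijφ}` for real `φ`. [folklore] -/
theorem conj_exp_two_I (φ : ℝ) (j : ℕ) :
    (starRingEnd ℂ) (Complex.exp (2 * I * φ * j)) = Complex.exp (-(2 * I * φ * j)) := by
  rw [← Complex.exp_conj]
  congr 1
  have : (2 * I * (φ : ℂ) * (j : ℂ)) = ((2 * φ * j : ℝ) : ℂ) * I := by push_cast; ring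
  rw [this, map_mul, Complex.conj_ofReal, Complex.conj_I]
  ring

/-- `‖S_n(φ)‖² = Σ_{j,j′<n} e^{2i(j−j′)φ}` (as a complex number). [folklore] -/
theorem normSq_dirichletSum_eq_double_sum (n : ℕ) (φ : ℝ) :
    ((‖dirichletSum n φ‖ : ℂ) ^ 2)
      = ∑ j ∈ range n, ∑ j' ∈ range n, Complex.exp (2 * I * φ * ((j : ℂ) - j')) := by
  rw [← Complex.mul_conj']
  unfold dirichletSum
  rw [map_sum, Finset.sum_mul_sum]
  refine Finset.sum_congr rfl fun j _ => Finset.sum_congr rfl fun j' _ => ?_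
  rw [conj_exp_two_I, ← Complex.exp_add]
  congr 1
  ring

/-- `Σ_{k<n} ‖S_n(θ + kπ/n)‖² = n²` — discrete orthogonality. [folklore] -/
theorem sum_norm_dirichletSum_sq {n : ℕ} (hn : n ≠ 0) (θ : ℝ) :
    ∑ k ∈ range n, ‖dirichletSum n (θ + k * Real.pi / n)‖ ^ 2 = (n : ℝ) ^ 2 := by
  -- the complex-valued version
  have hC : ∑ k ∈ range n, ((‖dirichletSum n (θ + k * Real.pi / n)‖ : ℂ) ^ 2) = (n : ℂ) ^ 2 := by
    simp_rw [normSq_dirichletSum_eq_double_sum]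
    -- exchange the k-sum inside
    rw [Finset.sum_comm]
    conv_lhs => arg 2; ext j; rw [Finset.sum_comm]
    -- split the exponential: e^{2i(θ + kπ/n)(j−j′)} = e^{2iθ(j−j′)} · e^{2πi (j−j′) k/n}
    have hn' : (n : ℂ) ≠ 0 := by exact_mod_cast hn
    have hsplit : ∀ (j j' k : ℕ),
        Complex.exp (2 * I * ((θ + k * Real.pi / n : ℝ) : ℂ) * ((j : ℂ) - j'))
          = Complex.exp (2 * I * θ * ((j : ℂ) - j'))
            * Complex.exp (2 * Real.pi * I * ((j : ℂ) - j') / n * k) := by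
      intro j j' k
      rw [← Complex.exp_add]; congr 1; push_cast; field_simp
    simp_rw [hsplit, ← Finset.mul_sum]
    -- inner k-sum by orthogonality
    rw [Finset.sum_congr rfl fun j hj => Finset.sum_congr rfl fun j' hj' => by
      rw [sum_exp_two_pi_mul_I_mul_div hn (mem_range.mp hj) (mem_range.mp hj')]]
    have hin : ∀ j ∈ range n,
        ∑ j' ∈ range n, Complex.exp (2 * I * θ * ((j : ℂ) - j')) * (if j = j' then (n : ℂ) else 0)
          = n := by
      intro j hj
      rw [Finset.sum_eq_single j]
      · simp
      · intro j' _ hne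
        rw [if_neg (Ne.symm hne), mul_zero]
      · intro h; exact absurd hj h
    rw [Finset.sum_congr rfl hin]
    simp [pow_two]
  exact_mod_cast hC

/-! ## §3 The `csc²` identity and the one-dimensional aliasing identity -/

/-- If `sin φ = 0` then `sin(nφ) = 0`. [folklore] -/
theorem sin_nat_mul_eq_zero_of_sin_eq_zero {φ : ℝ} (n : ℕ) (h : Real.sin φ = 0) :
    Real.sin (n * φ) = 0 := by
  rw [Real.sin_eq_zero_iff] at h
  obtain ⟨m, hm⟩ := h
  rw [← hm, Real.sin_eq_zero_iff]
  exact ⟨n * m, by push_cast; ring⟩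

/-- `sin²(n(θ + kπ/n)) = sin²(nθ)`. [folklore] -/
theorem sin_sq_nat_mul_shift {n : ℕ} (hn : n ≠ 0) (θ : ℝ) (k : ℕ) :
    Real.sin (n * (θ + k * Real.pi / n)) ^ 2 = Real.sin (n * θ) ^ 2 := by
  have hn' : (n : ℝ) ≠ 0 := by exact_mod_cast hn
  have : (n : ℝ) * (θ + k * Real.pi / n) = n * θ + k * Real.pi := by field_simp
  rw [this, Real.sin_add_nat_mul_pi, mul_pow]
  have h1 : ((-1 : ℝ) ^ k) ^ 2 = 1 := by
    rw [← pow_mul, mul_comm, pow_mul]; norm_num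
  rw [h1, one_mul]

/-- **The classical identity** `Σ_{k=0}^{n−1} 1/sin²(θ + kπ/n) = n²/sin²(nθ)` for `sin(nθ) ≠ 0`.
[folklore] -/
theorem sum_inv_sin_sq {n : ℕ} (hn : n ≠ 0) {θ : ℝ} (hθ : Real.sin (n * θ) ≠ 0) :
    ∑ k ∈ range n, (Real.sin (θ + k * Real.pi / n) ^ 2)⁻¹ = (n : ℝ) ^ 2 / Real.sin (n * θ) ^ 2 := by
  have hS := sum_norm_dirichletSum_sq hn θ
  have hterm : ∀ k ∈ range n, (Real.sin (θ + k * Real.pi / n) ^ 2)⁻¹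
      = ‖dirichletSum n (θ + k * Real.pi / n)‖ ^ 2 / Real.sin (n * θ) ^ 2 := by
    intro k _
    set φ := θ + k * Real.pi / n with hφdef
    have hφ : Real.sin φ ≠ 0 := by
      intro h0
      have := sin_nat_mul_eq_zero_of_sin_eq_zero n h0
      rw [← sq_eq_zero_iff, sin_sq_nat_mul_shift hn θ k, sq_eq_zero_iff] at this
      exact hθ this
    have h1 := norm_dirichletSum_sq_mul_sin_sq (n := n) hφ
    rw [sin_sq_nat_mul_shift hn θ k] at h1
    have hs2 : Real.sin φ ^ 2 ≠ 0 := pow_ne_zero 2 hφ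
    have hθ2 : Real.sin (n * θ) ^ 2 ≠ 0 := pow_ne_zero 2 hθ
    have hS0 : ‖dirichletSum n φ‖ ^ 2 ≠ 0 := by
      intro h0; rw [h0, zero_mul] at h1; exact hθ2 h1.symm
    have hSn : ‖dirichletSum n φ‖ ≠ 0 := fun h0 => hS0 (by rw [h0]; norm_num)
    rw [← h1, eq_div_iff (mul_ne_zero hS0 hs2)]
    field_simp
  rw [Finset.sum_congr rfl hterm, ← Finset.sum_div, hS]

/-- **The one-dimensional aliasing identity of block averaging** (King p. 671 "Since
`Σ_l |u_k^η(p′+l)|² = 1`"; DST 2024 "`Q_jQ_j^* = 1`"): with `n = L^k` fine points per block and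
`|u(q)|² = sin²(q/2)/(n² sin²(q/2n))`, `Σ_{k=0}^{n−1} |u(x + 2πk)|² = 1` whenever `sin(x/2) ≠ 0`.
[cite: King1986, p.671 (proof of Lemma 4.1, last sentence)] -/
theorem aliasing_identity {n : ℕ} (hn : n ≠ 0) {x : ℝ} (hx : Real.sin (x / 2) ≠ 0) :
    ∑ k ∈ range n, Real.sin (x / 2) ^ 2 / ((n : ℝ) ^ 2 * Real.sin ((x + 2 * Real.pi * k) / (2 * n)) ^ 2)
      = 1 := by
  have hn' : (n : ℝ) ≠ 0 := by exact_mod_cast hn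
  set θ := x / (2 * n) with hθdef
  have hnθ : (n : ℝ) * θ = x / 2 := by rw [hθdef]; field_simp
  have hθ : Real.sin (n * θ) ≠ 0 := by rw [hnθ]; exact hx
  have hang : ∀ k : ℕ, (x + 2 * Real.pi * k) / (2 * n) = θ + k * Real.pi / n := by
    intro k; rw [hθdef]; field_simp
  have hmain := sum_inv_sin_sq hn hθ
  rw [hnθ] at hmain
  have hx2 : Real.sin (x / 2) ^ 2 ≠ 0 := pow_ne_zero 2 hx
  calc ∑ k ∈ range n, Real.sin (x / 2) ^ 2 / ((n : ℝ) ^ 2 * Real.sin ((x + 2 * Real.pi * k) / (2 * n)) ^ 2)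
      = ∑ k ∈ range n, Real.sin (x / 2) ^ 2 / (n : ℝ) ^ 2 * (Real.sin (θ + k * Real.pi / n) ^ 2)⁻¹ := by
        refine Finset.sum_congr rfl fun k _ => ?_
        rw [hang k]; field_simp
    _ = Real.sin (x / 2) ^ 2 / (n : ℝ) ^ 2 * ∑ k ∈ range n, (Real.sin (θ + k * Real.pi / n) ^ 2)⁻¹ := by
        rw [Finset.mul_sum]
    _ = 1 := by rw [hmain]; field_simp

/-! ## §4 In the tree's vocabulary: `Σ_k B4Strip.uFactorr n k x = 1`, `Σ_k B4Strip.Ur n k s = 1` -/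

open Literature.MathematicalPhysics.QuantumFieldTheory.Balaban1983to89

/-- For `x ≠ 0` every alias factor of `B4Strip` is the sine ratio
`uFactorr n k x = sin²(x/2) / (n² sin²((x + 2πk)/(2n)))`. [cite: Balaban1983RegularityDecay, (2.45) p.584] -/
theorem uFactorr_eq_sin_ratio (n k : ℕ) {x : ℝ} (hx : x ≠ 0) :
    B4Strip.uFactorr n k x
      = Real.sin (x / 2) ^ 2 / ((n : ℝ) ^ 2 * Real.sin ((x + 2 * Real.pi * k) / (2 * n)) ^ 2) := by
  unfold B4Strip.uFactorr
  by_cases hk : k = 0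
  · subst hk
    simp only [if_true, hx, if_false, Nat.cast_zero, mul_zero, add_zero]
    rw [B4Strip.S1r_eq, B4Strip.Sxir_eq]
    by_cases hs : Real.sin (x / (2 * n)) = 0
    · simp [hs]
    · field_simp
  · simp only [hk, if_false]
    rw [B4Strip.S1r_eq, B4Strip.Sxir_eq]
    by_cases hs : Real.sin ((x + 2 * Real.pi * k) / (2 * n)) = 0
    · simp [hs]
    · field_simp

/-- At `x = 0` the `k = 0` factor is `1` (removable singularity filled in) and all other aliases vanish.
[cite: Balaban1983RegularityDecay, (2.45) p.584] -/
theorem uFactorr_zero_left (n k : ℕ) : B4Strip.uFactorr n k 0 = if k = 0 then 1 else 0 := by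
  unfold B4Strip.uFactorr
  by_cases hk : k = 0
  · simp [hk]
  · simp only [hk, if_false]
    rw [B4Strip.S1r_eq]
    simp

/-- **The aliasing identity for B4's alias factors, one coordinate**: on the Brillouin zone `|x| ≤ π`,
`Σ_{k : Fin n} uFactorr n k x = 1` (`n ≥ 1`). [cite: King1986, p.671; Balaban1983RegularityDecay, (2.45)–(2.49) pp.584–585] -/
theorem sum_uFactorr_eq_one {n : ℕ} (hn : 1 ≤ n) {x : ℝ} (hx : |x| ≤ Real.pi) :
    ∑ k : Fin n, B4Strip.uFactorr n k x = 1 := by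
  have hn0 : n ≠ 0 := by omega
  by_cases hx0 : x = 0
  · subst hx0
    simp_rw [uFactorr_zero_left]
    rw [Fin.sum_univ_eq_sum_range (fun k => if k = 0 then (1 : ℝ) else 0) n]
    rw [Finset.sum_ite_eq' (range n) 0 (fun _ => (1 : ℝ))]
    simp [Nat.pos_of_ne_zero hn0]
  · have hsin : Real.sin (x / 2) ≠ 0 := by
      intro h
      have hlt1 : -Real.pi < x / 2 := by
        have := abs_le.mp hx; linarith [Real.pi_pos]
      have hlt2 : x / 2 < Real.pi := by
        have := abs_le.mp hx; linarith [Real.pi_pos]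
      have := (Real.sin_eq_zero_iff_of_lt_of_lt hlt1 hlt2).mp h
      exact hx0 (by linarith)
    simp_rw [uFactorr_eq_sin_ratio n _ hx0]
    rw [Fin.sum_univ_eq_sum_range
      (fun k => Real.sin (x / 2) ^ 2 / ((n : ℝ) ^ 2 * Real.sin ((x + 2 * Real.pi * k) / (2 * n)) ^ 2)) n]
    exact aliasing_identity hn0 hsin

variable {d : ℕ}

/-- **The `d`-dimensional aliasing identity** for B4's `|u_j(p′+l)|² = Π_μ uFactorr` (`B4Strip.Ur`):
`Σ_{k : Fin d → Fin n} Ur n k s = Π_μ Σ_{k_μ} uFactorr n k_μ (s μ) = 1` for `|s_μ| ≤ π`, `n ≥ 1` — the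
real-momentum content of "`Σ_l |u_k^η(p′+l)|² = 1`".
[cite: King1986, p.671; Balaban1983RegularityDecay, (2.45)–(2.49) pp.584–585] -/
theorem sum_Ur_eq_one {n : ℕ} (hn : 1 ≤ n) {s : Fin d → ℝ} (hs : ∀ μ, |s μ| ≤ Real.pi) :
    ∑ k : Fin d → Fin n, B4Strip.Ur n k s = 1 := by
  unfold B4Strip.Ur
  rw [← Fintype.piFinset_univ, ← Finset.prod_univ_sum (fun _ => (Finset.univ : Finset (Fin n)))
    (fun μ kμ => B4Strip.uFactorr n (kμ : ℕ) (s μ))]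
  simp_rw [sum_uFactorr_eq_one hn (hs _)]
  simp

end Literature.MathematicalPhysics.QuantumFieldTheory.King1986

end
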